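import Literature.Probability.LatticeModels.CoarseCellMixingDefectsAnnealed
import HarnessLib

/-!
# Coarse-cell mixing with defects: UNIFORM two-exterior boundary influence (block-Markov case)

Companion of `CoarseCellMixingDefectsAnnealed.lean` (`annealed_influence_markov_defects`): the same van den Berg–Maes /
Dobrushin–Shlosman engine with Peierls-rare bad cells, stated WITHOUT a Gibbs measure — the conclusion bounds the
difference of the kernel expectations `γ_Λ f(ζ)`, `γ_Λ f(ζ')` of the volume `Λ := {v | cell v ∉ Δg}` for EVERY two
exteriors `ζ, ζ'` (hypothesis `Δg.Nonempty` added; same constants `q₀, κₑ, C`).  The proof is the annealed theorem's proof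
with its three `integral_abs_sub_le_of_uniform` (DLR) steps deleted: the short-distance case `D < 2` is the trivial bound,
the case `D ≥ 2` is `uniform_influence_multiCell` fed with `influence_decay_markov_defects`.

This is the form consumed by instances that carry no Gibbs measure on the site set (e.g. finite boxes of an infinite
lattice with frozen padding, where the infinite-volume / torus measure enters only through a far-factor DLR identity
downstream).

## References

* J. van den Berg, C. Maes, *Disagreement percolation in the study of Markov fields*, Ann. Probab. 22 (1994), §2;
  R. L. Dobrushin, S. B. Shlosman (1985), §2–3; H.-O. Georgii, *Gibbs Measures and Phase Transitions* (2011), §8.2.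
-/

noncomputable section

open _root_.MeasureTheory
open scoped ENNReal

namespace Literature.Probability.LatticeModels

universe u v

/-- **Uniform (two-exterior) boundary influence with defects, block-Markov case** — the van den Berg–Maes /
Dobrushin–Shlosman engine with rare bad cells, in the form WITHOUT a Gibbs measure: for every dimension `d` and window
`n` there are `q₀, κₑ > 0` and `C ≥ 0` (depending on `d, n` only) such that every block-Markov specification `γ` on a
coarse `d`-torus (`≥ 4n+3` cells per axis) with the good-exterior finite-size condition `(n, ε)`, `ε · shellCount d n ≤ 3/4`,
and the kernel-uniform Peierls bound at level `q ≤ q₀` satisfies, for every `[0,1]`-valued measurable observable `f` of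
the cells `Δf`, every NON-EMPTY cell set `Δg` at coarse distance `≥ D` from `Δf`, and EVERY two exteriors `ζ, ζ'`,
`|γ_Λ f(ζ) − γ_Λ f(ζ')| ≤ C e^{|Δf|} |Δg| e^{−κₑ D}` with `Λ :=` the sites whose cell is not in `Δg`
(same constants as `annealed_influence_markov_defects`, whose proof this is minus its three DLR steps:
`influence_decay_markov_defects` + `uniform_influence_multiCell`; `κₑ = −log θ`).  Typed by the crux-ideate seat
ym-cruxidea-19354-1 (g6, `Sketch-g6-port.lean` §4) for the Yang–Mills port of the engine onto box kernels, which carries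
no Gibbs measure. [cite: BergMaes1994, §2] -/
theorem uniform_influence_markov_defects (d n : ℕ) :
    ∃ q₀ κₑ C : ℝ, 0 < q₀ ∧ 0 < κₑ ∧ 0 ≤ C ∧
    ∀ {μc : Fin d → ℕ} {V : Type u} {S : Type v} [MeasurableSpace S] [Fintype V]
      (cell : V → CoarseIdx μc) (γ : Specification V S) (good : CoarseIdx μc → Set (V → S))
      (ε q r : ℝ),
      (∀ i, 4 * n + 3 ≤ μc i + 1) → IsSpecification γ →
      0 ≤ ε → ε * (Literature.Probability.LatticeModels.shellCount d n : ℝ) ≤ 3 / 4 → IsGoodFS cell γ good n ε →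
      HasBlockLeak cell γ 0 r → 0 ≤ q → q ≤ q₀ → UniformKernelPeierls cell γ good q →
      ∀ (f : (V → S) → ℝ) (Δf Δg : Finset (CoarseIdx μc)) (D : ℕ), Δg.Nonempty →
        Measurable f → (∀ σ, 0 ≤ f σ ∧ f σ ≤ 1) → DependsOn f {v | cell v ∈ Δf} →
        (∀ x ∈ Δf, ∀ y ∈ Δg, D ≤ cdist x y) →
        ∀ ζ ζ' : V → S,
          |∫ σ, f σ ∂(γ (Finset.univ.filter fun v => cell v ∉ Δg) ζ) -
              ∫ σ, f σ ∂(γ (Finset.univ.filter fun v => cell v ∉ Δg) ζ')| ≤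
            C * Real.exp (Δf.card) * Δg.card * Real.exp (-(κₑ * D)) := by
  obtain ⟨q₀d, θ, Cd, hq₀d, -, hθ, hθ1, hC1, hdec⟩ := influence_decay_markov_defects.{u, v} d n
  have h3d : (0 : ℝ) ≤ (3 : ℝ) ^ d := pow_nonneg (by norm_num) _
  have hX1 : (1 : ℝ) ≤ ((3 : ℝ) ^ d + 1) ^ 2 := one_le_pow₀ (by linarith)
  have hX0 : (0 : ℝ) < ((3 : ℝ) ^ d + 1) ^ 2 := by positivity
  have htpos : 0 < θ⁻¹ := inv_pos.2 hθ
  have hθt : θ * θ⁻¹ = 1 := mul_inv_cancel₀ hθ.ne'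
  have hC0 : 0 ≤ Cd := zero_le_one.trans hC1
  have hκ : 0 < -Real.log θ := neg_pos.2 (Real.log_neg hθ hθ1)
  refine ⟨min q₀d (θ ^ 2 / (8 * ((3 : ℝ) ^ d + 1) ^ 2)), -Real.log θ,
    Cd + 8 * Cd * (1 + 3 ^ d) + 4 * θ⁻¹ ^ 2 + θ⁻¹, lt_min hq₀d (by positivity), hκ,
    by positivity, ?_⟩
  intro μc V S _ _ cell γ good ε q r hμ hγ hε hεs hFS hBL hq hqq₀ hUKP f Δf Δg D hΔg hfm hf01
    hfdep hfar
  classical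
  -- the smallness facts on `q`
  have hqd : q ≤ q₀d := hqq₀.trans (min_le_left _ _)
  have hq8 : 8 * ((3 : ℝ) ^ d + 1) ^ 2 * q ≤ θ ^ 2 := by
    have h := hqq₀.trans (min_le_right _ _)
    rw [le_div_iff₀ (by positivity)] at h
    linarith
  have hθ2 : θ ^ 2 ≤ θ := by nlinarith
  have hXq0 : 0 ≤ ((3 : ℝ) ^ d + 1) ^ 2 * q := by positivity
  have hXqθ : ((3 : ℝ) ^ d + 1) ^ 2 * q ≤ θ := by nlinarith
  have hXq : ((3 : ℝ) ^ d + 1) ^ 2 * q ≤ 1 / 2 := by nlinarith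
  have hq1 : q ≤ 1 := by nlinarith
  have hXqt : 8 * ((3 : ℝ) ^ d + 1) ^ 2 * (q * θ⁻¹) ≤ 1 := by
    calc 8 * ((3 : ℝ) ^ d + 1) ^ 2 * (q * θ⁻¹) = 8 * ((3 : ℝ) ^ d + 1) ^ 2 * q * θ⁻¹ := by ring
      _ ≤ θ ^ 2 * θ⁻¹ := mul_le_mul_of_nonneg_right hq8 htpos.le
      _ = θ * (θ * θ⁻¹) := by ring
      _ ≤ 1 := by rw [hθt, mul_one]; exact hθ1.le
  -- `e^{-κₑ D} = θ^D`
  have hexpD : Real.exp (-(-Real.log θ * D)) = θ ^ D := by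
    rw [neg_mul, neg_neg, mul_comm, Real.exp_nat_mul, Real.exp_log hθ]
  rw [hexpD]
  have hexp1 : (1 : ℝ) ≤ Real.exp (Δf.card) := Real.one_le_exp (Nat.cast_nonneg _)
  have hθD : 0 ≤ θ ^ D := pow_nonneg hθ.le _
  set Λ : Finset V := Finset.univ.filter fun v => cell v ∉ Δg with hΛ
  have hg1 : (1 : ℝ) ≤ Δg.card := by exact_mod_cast Finset.card_pos.2 hΔg
  have hbig : θ⁻¹ ≤ (Cd + 8 * Cd * (1 + 3 ^ d) + 4 * θ⁻¹ ^ 2 + θ⁻¹) * Real.exp (Δf.card) *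
      Δg.card := by
    have h1 : θ⁻¹ ≤ Cd + 8 * Cd * (1 + 3 ^ d) + 4 * θ⁻¹ ^ 2 + θ⁻¹ := by
      have : 0 ≤ Cd + 8 * Cd * (1 + 3 ^ d) + 4 * θ⁻¹ ^ 2 := by positivity
      linarith
    have h0 : 0 ≤ Cd + 8 * Cd * (1 + 3 ^ d) + 4 * θ⁻¹ ^ 2 + θ⁻¹ := htpos.le.trans h1
    calc θ⁻¹ ≤ Cd + 8 * Cd * (1 + 3 ^ d) + 4 * θ⁻¹ ^ 2 + θ⁻¹ := h1
      _ = (Cd + 8 * Cd * (1 + 3 ^ d) + 4 * θ⁻¹ ^ 2 + θ⁻¹) * 1 * 1 := by ring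
      _ ≤ (Cd + 8 * Cd * (1 + 3 ^ d) + 4 * θ⁻¹ ^ 2 + θ⁻¹) * Real.exp (Δf.card) * Δg.card :=
          mul_le_mul (mul_le_mul_of_nonneg_left hexp1 h0) hg1 zero_le_one (by positivity)
  intro ζ ζ'
  by_cases hD2 : D < 2
  · -- short distances: the trivial bound `1 ≤ t θ^D`
    have htriv : |∫ σ, f σ ∂(γ Λ ζ) - ∫ σ, f σ ∂(γ Λ ζ')| ≤ 1 := by
      haveI := hγ.isProbability Λ ζ
      haveI := hγ.isProbability Λ ζ'
      obtain ⟨h1, h2⟩ := integral_mem_unitInterval (μ := γ Λ ζ) hfm hf01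
      obtain ⟨h3, h4⟩ := integral_mem_unitInterval (μ := γ Λ ζ') hfm hf01
      rw [abs_le]; constructor <;> linarith
    refine htriv.trans ?_
    have hθD1 : θ ≤ θ ^ D := by
      have := pow_le_pow_of_le_one hθ.le hθ1.le (show D ≤ 1 by omega)
      rwa [pow_one] at this
    calc (1 : ℝ) = θ⁻¹ * θ := by rw [mul_comm, hθt]
      _ ≤ θ⁻¹ * θ ^ D := mul_le_mul_of_nonneg_left hθD1 htpos.le
      _ ≤ (Cd + 8 * Cd * (1 + 3 ^ d) + 4 * θ⁻¹ ^ 2 + θ⁻¹) * Real.exp (Δf.card) * Δg.card *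
            θ ^ D := mul_le_mul_of_nonneg_right hbig hθD
  · -- `D ≥ 2`: the uniform multi-cell bound
    have hD : 2 ≤ D := not_lt.1 hD2
    have hsup : |∫ σ, f σ ∂(γ Λ ζ) - ∫ σ, f σ ∂(γ Λ ζ')| ≤
        (Cd + 8 * Cd * (1 + 3 ^ d) + 4 * θ⁻¹ ^ 2) * Real.exp (Δf.card) * θ ^ D :=
      uniform_influence_multiCell hγ hFS.good_local hFS.good_meas hBL hq hq1 hθ hθ1.le
        rfl hC0 hXq hXqθ hXqt hUKP Δg
        (fun D' x hx Λ' hΛ' ζ₁ ζ₁' hadm g hgm hg01 hgdep =>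
          hdec cell γ good ε q r hμ hγ hFS.good_local hFS.good_meas hε hεs hFS hBL hq hqd hUKP D'
            Δg x hx Λ' hΛ' ζ₁ ζ₁' hadm g hgm hg01 hgdep)
        Δf hD hfar ζ ζ' f hfm hf01 hfdep
    refine hsup.trans ?_
    have hB0 : 0 ≤ (Cd + 8 * Cd * (1 + 3 ^ d) + 4 * θ⁻¹ ^ 2 + θ⁻¹) * Real.exp (Δf.card) := by
      positivity
    calc (Cd + 8 * Cd * (1 + 3 ^ d) + 4 * θ⁻¹ ^ 2) * Real.exp (Δf.card) * θ ^ D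
        ≤ (Cd + 8 * Cd * (1 + 3 ^ d) + 4 * θ⁻¹ ^ 2 + θ⁻¹) * Real.exp (Δf.card) * θ ^ D :=
          mul_le_mul_of_nonneg_right (mul_le_mul_of_nonneg_right (by linarith)
            (zero_le_one.trans hexp1)) hθD
      _ = (Cd + 8 * Cd * (1 + 3 ^ d) + 4 * θ⁻¹ ^ 2 + θ⁻¹) * Real.exp (Δf.card) * 1 * θ ^ D := by
          rw [mul_one]
      _ ≤ (Cd + 8 * Cd * (1 + 3 ^ d) + 4 * θ⁻¹ ^ 2 + θ⁻¹) * Real.exp (Δf.card) * Δg.card *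
            θ ^ D := mul_le_mul_of_nonneg_right (mul_le_mul_of_nonneg_left hg1 hB0) hθD

end Literature.Probability.LatticeModels

end
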